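import Mathlib
import Summits.Ventures.HodgeRepro.Tier4.Common.AdelicDefs
import Summits.Ventures.HodgeRepro.Tier4.Common.CongruenceAdeles
import Summits.Ventures.HodgeRepro.Tier4.Common.CompactOpenLevel
import Summits.Ventures.HodgeRepro.Tier4.Common.RowPlane
import Summits.Ventures.HodgeRepro.Tier4.Line1.AdelicParts
import Summits.Ventures.HodgeRepro.Tier4.Line4.LevelCosetCongruence

/-!
# Tier4/Line4/IntegralTransport — an integral multiple of the transport `g` (the `hg` binder of OrbitInvariantFinite)

Blind re-derivation cell `pub-hodge-repro`, Tier 4 «prove the step» (README §9–§10), seat t4-L1-p3 (gen 4).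
Tree path `lean/Summits/Ventures/HodgeRepro/Tier4/Line4/IntegralTransport.lean`.

OrbitInvariantFinite's congruence needs the transport `g` FINITE-INTEGRAL (`hg : IsIntegralFinMat (adMat k g)`).  The
skeleton's `g` is any rational `E′`-linear similitude; this file clears its denominators: there is a non-zero integer
`b ∈ 𝓞_k` with `b • g` integral (`exists_integer_smul_integral`), `b • g` is finite-integral
(`isIntegralFinMat_adMat_of_forall_exists`, via `finPart_algebraMap_mem_integralSet`: a principal adele of an
algebraic integer has integral finite part), and `b • g` carries the same transport data — inverse `b⁻¹ • g'`
(`smul_mul_inv_smul`), `E′`-linearity (`smul_mul_Ω`), the similitude with `λ` replaced by `b² λ` (`smul_similitude`)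
— so every theorem of OrbitInvariant / OrbitInvariantFinite / OrbitInvariantOrbit applies at `b • g` verbatim.
No printed input.  HC_CM is NOT proved by anyone in this repository.
-/

namespace Summit.Ventures.HodgeRepro.Tier4.Line4

open Summit.Ventures.HodgeRepro.Tier4.Common Summit.Ventures.HodgeRepro.Tier4.Line1 NumberField
  IsDedekindDomain Matrix
open scoped NumberField

section Integral

variable {k : Type} [Field k] [NumberField k]

/-- A principal adele of an algebraic integer has integral finite part. -/
theorem finPart_algebraMap_mem_integralSet (z : 𝓞 k) :
    finPart k (algebraMap k (Ad k) (z : k)) ∈ integralSet k := by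
  intro v
  rw [finPart_algebraMap, FiniteAdeleRing.algebraMap_apply, HeightOneSpectrum.mem_adicCompletionIntegers,
    HeightOneSpectrum.valuedAdicCompletion_eq_valuation']
  exact HeightOneSpectrum.valuation_le_one v z

/-- A rational matrix with integral entries is finite-integral. -/
theorem isIntegralFinMat_adMat_of_forall_exists {g : Matrix (Fin 4) (Fin 4) k}
    (hg : ∀ i j, ∃ z : 𝓞 k, g i j = z) : IsIntegralFinMat (adMat k g) := by
  intro i j
  obtain ⟨z, hz⟩ := hg i j
  simp only [adMat, Matrix.map_apply, hz]
  exact finPart_algebraMap_mem_integralSet z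

/-- **Clearing denominators**: every rational matrix has a non-zero integer multiple with integral entries. -/
theorem exists_integer_smul_integral (g : Matrix (Fin 4) (Fin 4) k) :
    ∃ b : 𝓞 k, b ≠ 0 ∧ ∀ i j, ∃ z : 𝓞 k, ((b : k) • g) i j = z := by
  obtain ⟨b, hb⟩ := IsLocalization.exist_integer_multiples (nonZeroDivisors (𝓞 k))
    (Finset.univ : Finset (Fin 4 × Fin 4)) (fun p => g p.1 p.2)
  refine ⟨(b : 𝓞 k), nonZeroDivisors.coe_ne_zero b, fun i j => ?_⟩
  obtain ⟨z, hz⟩ := hb (i, j) (Finset.mem_univ _)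
  refine ⟨z, ?_⟩
  have hz' : algebraMap (𝓞 k) k z = ((b : 𝓞 k) : k) * g i j := by
    rw [hz, Algebra.smul_def]
  rw [Matrix.smul_apply, smul_eq_mul, ← hz']

/-- The integral multiple, packaged: `b ≠ 0` and `b • g` finite-integral. -/
theorem exists_integer_smul_isIntegralFinMat (g : Matrix (Fin 4) (Fin 4) k) :
    ∃ b : 𝓞 k, b ≠ 0 ∧ IsIntegralFinMat (adMat k ((b : k) • g)) := by
  obtain ⟨b, hb0, hb⟩ := exists_integer_smul_integral g
  exact ⟨b, hb0, isIntegralFinMat_adMat_of_forall_exists hb⟩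

end Integral

section Transport

variable {k : Type} [Field k]

/-- The inverse of `c • g` is `c⁻¹ • g'`. -/
theorem smul_mul_inv_smul {g g' : Matrix (Fin 4) (Fin 4) k} (hgg' : g * g' = 1) {c : k} (hc : c ≠ 0) :
    (c • g) * (c⁻¹ • g') = 1 := by
  rw [Matrix.smul_mul, Matrix.mul_smul, smul_smul, mul_inv_cancel₀ hc, one_smul, hgg']

/-- `c • g` commutes with `Ω` when `g` does. -/
theorem smul_mul_Ω {g Ω : Matrix (Fin 4) (Fin 4) k} (hgΩ : g * Ω = Ω * g) (c : k) :
    (c • g) * Ω = Ω * (c • g) := by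
  rw [Matrix.smul_mul, Matrix.mul_smul, hgΩ]

/-- `c • g` is a similitude with multiplier `c² λ` when `g` is one with multiplier `λ`. -/
theorem smul_similitude {g B' B : Matrix (Fin 4) (Fin 4) k} {lam : k} (hiso : g * B' * gᵀ = lam • B) (c : k) :
    (c • g) * B' * (c • g)ᵀ = (c ^ 2 * lam) • B := by
  rw [Matrix.transpose_smul, Matrix.smul_mul, Matrix.smul_mul, Matrix.mul_smul, hiso, smul_smul, smul_smul]
  congr 1
  ring

end Transport

end Summit.Ventures.HodgeRepro.Tier4.Line4
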